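import Literature.MathematicalPhysics.QuantumFieldTheory.Balaban1983to89.T4HaarSU2ExpChart
import Literature.MathematicalPhysics.QuantumFieldTheory.Balaban1983to89.UnitaryModel
import Literature.MathematicalPhysics.QuantumFieldTheory.Balaban1983to89.AveragingRT

/-!
# `Summit.QuantumFields.Balaban3D.Proofs.ProductChartSU2` — «dU′ = Π_b σ(A′(b)) dA′(b)» ON A WHOLE FIELD for the printed example
# group G = SU(2): the product Haar measure `fieldMeasure` on `SU(2)`-valued gauge fields is the push-forward of the product of
# the exponential chart laws under the bondwise exponential — [Balaban1985UV3] (18) p. 260 / (51) p. 268 («The integration is expressed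
# now in terms of the variables V′_k = e^{iA′}», «dU′ = σ(A′)dA′ … for G = SU(2) we have σ(A) = (2π²)⁻¹(sin|A|/|A|)²») for every
# bond at once — lane `pub-balaban3d`, seat p4 (item F4/F8 of HOME/drafts/p4/FIBRE49.md: the measure-theoretic half of the chart step)

HONEST FRAMING (lane PLAN.md §0, binding): see `…Proofs.SectAFirstStep`.  [folklore] product measure theory over LQB's single-variable
certificate `T4HaarSU2ExpChart.map_expPoint_expMeasure` (Haar(SU(2)) = push-forward of `expMeasure = (2π²)⁻¹sinc²‖x‖·1_{‖x‖<π}d³x` under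
`expPoint`) and the instance `UnitaryModel.instHaarDataSpecialUnitaryGroup` (`HaarData.haar = haarProbability SU(2)` by `rfl`); nothing of
the paper is asserted.  General compact semisimple G: the chart density σ of (18) stays a binder of the group model (R-SEMI); this file is
the SU(2) witness, bond-product form of seat p4's `ChartSU2`.

WHAT THIS FILE PROVES (no `sorry`, axioms standard): `expField` (bondwise exponential chart), `measurePreserving_expField`
(`(⊗_b expMeasure) ∘ expField⁻¹ = dU`, Mathlib `measurePreserving_pi`), **`integral_fieldMeasure_su2_eq_integral_chart`**
(`∫ F(U) dU = ∫ F(exp∘A) d(⊗_b expMeasure)` for every `F` a.e.-strongly measurable), `fieldMeasure_su2_eq_map`.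
-/

noncomputable section

namespace Summit.QuantumFields.Balaban3D.Proofs.ProductChartSU2

open _root_.MeasureTheory
open Literature.MathematicalPhysics.QuantumFieldTheory (haarProbability)
open Literature.MathematicalPhysics.QuantumFieldTheory.Balaban1983to89
open Literature.MathematicalPhysics.QuantumFieldTheory.Balaban1983to89.T4HaarSU2ExpChart (expPoint expMeasure
  map_expPoint_expMeasure measurable_expPoint)

/-- `SU(2)` as the lane's gauge group (LQB `UnitaryModel` instances). -/
abbrev SU2 : Type := Matrix.specialUnitaryGroup (Fin 2) ℂ

variable {P : Params} {j : ℕ}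

/-- The BONDWISE EXPONENTIAL CHART `A ↦ (b ↦ exp(iA(b)))` from `𝔰𝔲(2) ≅ ℝ³`-valued bond functions to `SU(2)`-valued gauge fields
((13) p. 259 «V′ = e^{iA′}», (51) p. 268 «V′_k = e^{iA′}»). [cite: Balaban1985UV3, (13) p.259 + (51) p.268] -/
def expField (A : PBond P j → EuclideanSpace ℝ (Fin 3)) : GaugeField P j SU2 := fun b => expPoint (A b)

/-- The bondwise chart is measurable. [folklore] -/
theorem measurable_expField : Measurable (expField (P := P) (j := j)) :=
  measurable_pi_iff.mpr fun b => measurable_expPoint.comp (measurable_pi_apply b)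

/-- **«dU′ = Π_b σ(A′(b)) dA′(b)»** for G = SU(2): the bondwise exponential chart pushes the product of the chart laws `⊗_b expMeasure`
(each `= (2π²)⁻¹ sinc²‖x‖ · 1_{‖x‖<π} d³x`, LQB `lintegral_expMeasure`) forward to the product Haar measure `dU` on `SU(2)`-valued fields
(`Setup.fieldMeasure`; LQB `map_expPoint_expMeasure` bond by bond, Mathlib `measurePreserving_pi`). [cite: Balaban1985UV3, (18) p.260] -/
theorem measurePreserving_expField :
    MeasurePreserving (expField (P := P) (j := j))
      (Measure.pi fun _ : PBond P j => expMeasure) (fieldMeasure P j SU2) := by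
  have h : ∀ _ : PBond P j, MeasurePreserving expPoint expMeasure (HaarData.haar : Measure SU2) := fun _ =>
    ⟨measurable_expPoint, map_expPoint_expMeasure⟩
  unfold fieldMeasure expField
  exact measurePreserving_pi (fun _ : PBond P j => expMeasure) (fun _ => (HaarData.haar : Measure SU2)) h

/-- The product Haar measure on `SU(2)`-fields IS the push-forward of the product chart law. [folklore] -/
theorem fieldMeasure_su2_eq_map :
    fieldMeasure P j SU2 = (Measure.pi fun _ : PBond P j => expMeasure).map (expField (P := P) (j := j)) :=
  (measurePreserving_expField (P := P) (j := j)).map_eq.symm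

/-- **Integration over `SU(2)`-fields in the exponential chart**: `∫ F(U) dU = ∫ F(b ↦ exp(iA(b))) d(⊗_b expMeasure)(A)` for every
`F` a.e.-strongly measurable for `dU` — print's «The integration is expressed now in terms of the variables V′ = e^{iA′}» with the
density «dU′ = σ(A′)dA′» carried by `expMeasure` on each bond. [cite: Balaban1985UV3, (18) p.260 + (51) p.268] -/
theorem integral_fieldMeasure_su2_eq_integral_chart {F : Type*} [NormedAddCommGroup F] [NormedSpace ℝ F]
    (f : GaugeField P j SU2 → F) (hf : AEStronglyMeasurable f (fieldMeasure P j SU2)) :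
    ∫ U, f U ∂(fieldMeasure P j SU2) = ∫ A, f (expField A) ∂(Measure.pi fun _ : PBond P j => expMeasure) := by
  rw [fieldMeasure_su2_eq_map, integral_map (measurable_expField (P := P) (j := j)).aemeasurable]
  · rw [← fieldMeasure_su2_eq_map]; exact hf

end Summit.QuantumFields.Balaban3D.Proofs.ProductChartSU2

end
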